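import Summits.Ventures.PercRepro.S2ElevenSevenK2SpreadB
import Summits.Ventures.PercRepro.S2ThirteenSevenNuFive

/-!
# PercRepro — S2: THE CASES `ν = 6` AND `ν = 5` OF THE TWICE-SCALED CELL `(11, 7)` AT `K₂ = 12107`, AND THE CELL MODULO `ν = 4`
(p7, gen 17; sub-claim S2; the second coloop step of the cell `(13, 7)`)

S2ThirteenSevenNuFive at `18` points (rank `11`, coloops allowed, the standard caps `11 / 69 / 401`, `K₂ = 12107`, the weighted
inequality `(Φ(13, 5) − 6)/4 · #U(11, 5) ≤ mid(11, 5)`): the case `ν = 6` by the kit's hitting counts against the kit's tail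
(`#U ≤ 10032`, `#spanning ≤ 12218`, `m = 353`, ratio `0.31`); the case `ν = 5` by the complement lever (the tail by flats at `(10, 9)` =
`14588414/225`, `#U ≤ 18726`, `#spanning ≤ 25616`, `m = 354`, ratio `0.59`). **`c025_eleven_seven_k2_nu_six`**,
**`c025_eleven_seven_k2_nu_five`**; with the unconditional spread case of `S2ElevenSevenK2SpreadB`: **`c025_eleven_seven_k2_of_nu_four`**
(the twice-scaled cell modulo its case `ν = 4`). Nothing about any cell is claimed. Axioms: standard.
-/

open scoped Matroid

namespace PercRepro

namespace ThmN

open Set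

variable {α : Type}

/-- The tail side of the twice-scaled cell `(11, 7)` on the caps `11 / 69 / 401` with the spanning count `S` a parameter: the rank-`≤ 5` part
of the kit's tail is exactly `461959823 / 5922`. -/
theorem tail_eleven_seven (S m : ℕ) (h : (1024 : ℚ) * ((461959823 / 5922 : ℚ) + (S : ℚ)) ≤ (m : ℚ) * 2 ^ 18) :
    1024 * ((((11 + 7).choose 4 : ℚ) +
      (∑ j ∈ Finset.range 6, (Nat.choose (min 5 ((7 + 3) / 2 + 1 - 2)) j : ℚ) / (((j + 1) + 3 * (j + 1).choose 2 + 3 * (j + 1).choose 3 + 2 * (j + 1).choose 4 : ℕ) : ℚ)) *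
        ((11 * (11 + 7 - 3).choose 2 + 69 * (11 + 7 - 4) + 401 : ℕ) : ℚ) +
      ((∑ j ∈ Finset.range 6, (Nat.choose 5 j : ℚ) / (((j + 1) + 3 * (j + 1).choose 2 + 3 * (j + 1).choose 3 + 2 * (j + 1).choose 4 : ℕ) : ℚ)) -
        (∑ j ∈ Finset.range 6, (Nat.choose (min 5 ((7 + 3) / 2 + 1 - 2)) j : ℚ) / (((j + 1) + 3 * (j + 1).choose 2 + 3 * (j + 1).choose 3 + 2 * (j + 1).choose 4 : ℕ) : ℚ))) *
        ((10 : ℕ).choose 5 : ℚ)) +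
      (((11 + 7).choose 3 * 2 ^ 3 + (11 + 7).choose 2 * 2 + (11 + 7) + 1 : ℕ) : ℚ) +
      (((11 + 7).choose 5 : ℚ) + (∑ j ∈ Finset.range (7), (Nat.choose (min 13 ((7 + 6) / 2 + 1 - 2)) j : ℚ) / (((j + 1) + 3 * (j + 1).choose 2 + 3 * (j + 1).choose 3 + 2 * (j + 1).choose 4 : ℕ) : ℚ)) * ((11 * (11 + 7 - 3).choose 3 + 69 * (11 + 7 - 4).choose 2 + 401 * (11 + 7 - 5) + (7 + 5).choose 6 : ℕ) : ℚ) +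
        ((∑ j ∈ Finset.range (7), (Nat.choose (min 19 (5 + 7) - 6) j : ℚ) / (((j + 1) + 3 * (j + 1).choose 2 + 3 * (j + 1).choose 3 + 2 * (j + 1).choose 4 : ℕ) : ℚ)) - (∑ j ∈ Finset.range (7), (Nat.choose (min 13 ((7 + 6) / 2 + 1 - 2)) j : ℚ) / (((j + 1) + 3 * (j + 1).choose 2 + 3 * (j + 1).choose 3 + 2 * (j + 1).choose 4 : ℕ) : ℚ))) *
        ((min 19 (5 + 7)).choose 6 : ℚ)) +
      (S : ℚ)) ≤ (m : ℚ) * 2 ^ (11 + 7) := by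
  have hsm : (∑ j ∈ Finset.range (7), (Nat.choose (min 13 ((7 + 6) / 2 + 1 - 2)) j : ℚ) / (((j + 1) + 3 * (j + 1).choose 2 + 3 * (j + 1).choose 3 + 2 * (j + 1).choose 4 : ℕ) : ℚ)) = 12767 / 4230 := by
    norm_num [Finset.sum_range_succ, Nat.choose]
  have hsg : (∑ j ∈ Finset.range (7), (Nat.choose (min 19 (5 + 7) - 6) j : ℚ) / (((j + 1) + 3 * (j + 1).choose 2 + 3 * (j + 1).choose 3 + 2 * (j + 1).choose 4 : ℕ) : ℚ)) = 414767 / 103635 := by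
    norm_num [Finset.sum_range_succ, Nat.choose]
  have hs4m : (∑ j ∈ Finset.range 6, (Nat.choose (min 5 ((7 + 3) / 2 + 1 - 2)) j : ℚ) / (((j + 1) + 3 * (j + 1).choose 2 + 3 * (j + 1).choose 3 + 2 * (j + 1).choose 4 : ℕ) : ℚ)) = 523 / 225 := by
    norm_num [Finset.sum_range_succ, Nat.choose]
  have hs4g : (∑ j ∈ Finset.range 6, (Nat.choose 5 j : ℚ) / (((j + 1) + 3 * (j + 1).choose 2 + 3 * (j + 1).choose 3 + 2 * (j + 1).choose 4 : ℕ) : ℚ)) = 12767 / 4230 := by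
    norm_num [Finset.sum_range_succ, Nat.choose]
  rw [hsm, hsg, hs4m, hs4g]
  norm_num [Nat.choose] at h ⊢
  linarith

/-- **The case `ν = 6` of the twice-scaled cell `(11, 7)` at `K₂`**: a set of nullity `6` on `≤ 11` points, by the kit's hitting counts
(`#U ≤ 10032`, `#spanning ≤ 12218`, `m = 353`). -/
theorem c025_eleven_seven_k2_nu_six (M : Matroid α) [M.Finite]
    (hR : M.eRank = ((11 : ℕ) : ℕ∞)) (hn : M.E.ncard = 11 + 7)
    (hfree : ∀ e ∈ M.E, ∃ A ⊆ M.E \ {e}, e ∉ M.closure A ∧ e ∉ M.closure ((M.E \ {e}) \ A))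
    (h6 : ∃ W ⊆ M.E, W.ncard ≤ 11 ∧ W.encard = M.eRk W + 6) :
    ((phiK 13 5 - 6) / 4) * (Matroid.topCount M 11 5 : ℚ) ≤ (Matroid.midCount M 11 5 : ℚ) := by
  classical
  have hd : M.E.encard = M.eRank + ((7 : ℕ) : ℕ∞) := by
    rw [hR, ← M.ground_finite.cast_ncard_eq, hn]
    push_cast
    ring
  obtain ⟨hs3, hs4, hs5⟩ := caps_eleven_seven M hd hfree
  obtain ⟨W, hW, hWn, hWk⟩ := h6
  have full : Matroid.topCount M 11 5 ≤ ∑ m ∈ Finset.Icc 5 7, ∑ j ∈ Finset.Icc (m + 6 - 7) m,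
      W.ncard.choose j * (11 + 7 - W.ncard).choose (m - j) := by
    refine (S2.topCount_le_sum_spanning M hR hd 5).trans ?_
    refine Finset.sum_le_sum (fun m _ => ?_)
    have h := S2.ncard_spanning_compl_le_of_nullity M hW hd hWk (m := m)
    rw [hn] at h
    exact h
  have hU' : Matroid.topCount M 11 5 ≤ 10032 := by
    refine full.trans ?_
    generalize W.ncard = w at hWn ⊢
    interval_cases w <;> decide
  have hS' : {X : Set α | X ⊆ M.E ∧ M.eRk X = M.eRank}.ncard ≤ 12218 := by
    refine (S2.ncard_spanning_le_of_nullity M hW hd hWk).trans ?_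
    rw [hn]
    generalize W.ncard = w at hWn ⊢
    interval_cases w <;> decide
  exact c025_core_five_cell_of_topCount_spanning_xqictq5g M 11 7 (by norm_num) hR hn hfree 11 69 401 hs3 hs4 hs5 10032 hU'
    12218 hS' 12107 (by norm_num) ((phiK 13 5 - 6) / 4) (by rw [phiK_thirteen_five]; norm_num)
    ⟨353, by norm_num, by norm_num, tail_eleven_seven 12218 353 (by norm_num)⟩

/-- **The case `ν = 5` of the twice-scaled cell `(11, 7)` at `K₂`** (see the module docstring): a flat `W` of nullity `5` on `≤ 10`
points, no set of nullity `6` on `≤ 11` points; the top `7`-sets by the complement lever. -/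
theorem c025_eleven_seven_k2_nu_five (M : Matroid α) [M.Finite]
    (hR : M.eRank = ((11 : ℕ) : ℕ∞)) (hn : M.E.ncard = 11 + 7)
    (hfree : ∀ e ∈ M.E, ∃ A ⊆ M.E \ {e}, e ∉ M.closure A ∧ e ∉ M.closure ((M.E \ {e}) \ A))
    (h6 : ¬ ∃ W ⊆ M.E, W.ncard ≤ 11 ∧ W.encard = M.eRk W + 6)
    (h5 : ∃ W ⊆ M.E, W.ncard ≤ 10 ∧ W.encard = M.eRk W + 5) :
    ((phiK 13 5 - 6) / 4) * (Matroid.topCount M 11 5 : ℚ) ≤ (Matroid.midCount M 11 5 : ℚ) := by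
  classical
  have hd : M.E.encard = M.eRank + ((7 : ℕ) : ℕ∞) := by
    rw [hR, ← M.ground_finite.cast_ncard_eq, hn]
    push_cast
    ring
  obtain ⟨hs3, hs4, hs5⟩ := caps_eleven_seven M hd hfree
  have hEfin := M.ground_finite
  have hflat : ∀ X ⊆ M.E, M.eRk X ≤ 5 → X.ncard ≤ 10 := fun X hX hr => by
    have := S2.ncard_le_of_eRk_le_of_not_nullity M 6 11 (by norm_num) h6 hX (r := 5) (by norm_num) (by exact_mod_cast hr)
    omega
  have hflat' : ∀ X ⊆ M.E, M.eRk X ≤ 4 → X.ncard ≤ 9 := fun X hX hr => by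
    have := S2.ncard_le_of_eRk_le_of_not_nullity M 6 11 (by norm_num) h6 hX (r := 4) (by norm_num) (by exact_mod_cast hr)
    omega
  -- the set `W`
  obtain ⟨W, hW, hWn, hWk⟩ := h5
  have hWfin : W.Finite := hEfin.subset hW
  have hWne : M.eRk W ≠ ⊤ := ((M.eRk_le_encard W).trans_lt hWfin.encard_lt_top).ne
  -- `W` is a flat
  have hWcl : M.closure W = W := by
    refine le_antisymm ?_ (M.subset_closure W hW)
    intro x hx
    by_contra hxW
    have hxE : x ∈ M.E := M.closure_subset_ground W hx
    apply h6
    refine ⟨insert x W, Set.insert_subset hxE hW, ?_, ?_⟩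
    · rw [Set.ncard_insert_of_notMem hxW hWfin]; omega
    · rw [Set.encard_insert_of_notMem hxW, ← M.eRk_closure_eq, M.closure_insert_eq_of_mem_closure hx,
        M.eRk_closure_eq, hWk]
      ring
  have hRW : (M.E \ W).ncard = 18 - W.ncard := by
    rw [Set.ncard_sdiff hW hWfin, hn]
  -- the hitting bound for the top `7`-sets
  have hhit7 : ∀ B, B ⊆ M.E → B.ncard = 7 → M.eRk B = 5 → M.eRk (M.E \ B) = M.eRank → 5 ≤ (B ∩ W).ncard := by
    intro B hBE hB7 _ hBs
    have h := S2.encard_add_le_of_spanning_compl_of_nullity M hBE hW hBs hd hWk hWne (by rw [hR]; exact WithTop.natCast_ne_top 11)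
    rw [Set.inter_comm, ← (hEfin.subset hBE).cast_ncard_eq, ← ((hEfin.subset hBE).inter_of_left W).cast_ncard_eq] at h
    have h' : B.ncard + 5 ≤ 7 + (B ∩ W).ncard := by exact_mod_cast h
    omega
  -- the top count: `5`-, `6`- and `7`-sets
  have hU1 := S2.topCount_le_ncard_compl_spanning (M := M) hR hd 5
  simp only [Nat.cast_ofNat] at hU1
  have hF1 : {B : Set α | B ⊆ M.E ∧ B.ncard = 5 ∧ M.eRk (M.E \ B) = M.eRank}.Finite :=
    hEfin.finite_subsets.subset (fun B hB => hB.1)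
  have hF2 : {B : Set α | B ⊆ M.E ∧ B.ncard = 6 ∧ M.eRk B = 5 ∧ M.eRk (M.E \ B) = M.eRank}.Finite :=
    hEfin.finite_subsets.subset (fun B hB => hB.1)
  have hF3 : {B : Set α | B ⊆ M.E ∧ B.ncard = 7 ∧ M.eRk B = 5 ∧ M.eRk (M.E \ B) = M.eRank}.Finite :=
    hEfin.finite_subsets.subset (fun B hB => hB.1)
  have hsplitU : {B : Set α | B ⊆ M.E ∧ M.eRk B = 5 ∧ B.ncard ≤ 7 ∧ M.eRk (M.E \ B) = M.eRank}.ncard ≤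
      {B : Set α | B ⊆ M.E ∧ B.ncard = 5 ∧ M.eRk (M.E \ B) = M.eRank}.ncard +
      {B : Set α | B ⊆ M.E ∧ B.ncard = 6 ∧ M.eRk B = 5 ∧ M.eRk (M.E \ B) = M.eRank}.ncard +
      {B : Set α | B ⊆ M.E ∧ B.ncard = 7 ∧ M.eRk B = 5 ∧ M.eRk (M.E \ B) = M.eRank}.ncard := by
    refine le_trans (Set.ncard_le_ncard ?_ ((hF1.union hF2).union hF3)) ?_
    · rintro B ⟨hBE, hB5, hB7, hBs⟩
      have hBfin : B.Finite := hEfin.subset hBE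
      have h5le : 5 ≤ B.ncard := by
        have := M.eRk_le_encard B
        rw [hB5, ← hBfin.cast_ncard_eq] at this
        exact_mod_cast this
      rcases (show B.ncard = 5 ∨ B.ncard = 6 ∨ B.ncard = 7 by omega) with h | h | h
      · exact Or.inl (Or.inl ⟨hBE, h, hBs⟩)
      · exact Or.inl (Or.inr ⟨hBE, h, hB5, hBs⟩)
      · exact Or.inr ⟨hBE, h, hB5, hBs⟩
    · have h1 := Set.ncard_union_le ({B : Set α | B ⊆ M.E ∧ B.ncard = 5 ∧ M.eRk (M.E \ B) = M.eRank} ∪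
        {B : Set α | B ⊆ M.E ∧ B.ncard = 6 ∧ M.eRk B = 5 ∧ M.eRk (M.E \ B) = M.eRank})
        {B : Set α | B ⊆ M.E ∧ B.ncard = 7 ∧ M.eRk B = 5 ∧ M.eRk (M.E \ B) = M.eRank}
      have h2 := Set.ncard_union_le {B : Set α | B ⊆ M.E ∧ B.ncard = 5 ∧ M.eRk (M.E \ B) = M.eRank}
        {B : Set α | B ⊆ M.E ∧ B.ncard = 6 ∧ M.eRk B = 5 ∧ M.eRk (M.E \ B) = M.eRank}
      omega
  -- the `5`- and `6`-sets by the kit's hitting counts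
  have htop5 := S2.ncard_spanning_compl_le_of_nullity M hW hd hWk (m := 5)
  have htop6 : {B : Set α | B ⊆ M.E ∧ B.ncard = 6 ∧ M.eRk B = 5 ∧ M.eRk (M.E \ B) = M.eRank}.ncard ≤
      ∑ j ∈ Finset.Icc (6 + 5 - 7) 6, W.ncard.choose j * (M.E.ncard - W.ncard).choose (6 - j) := by
    have hsub : {B : Set α | B ⊆ M.E ∧ B.ncard = 6 ∧ M.eRk B = 5 ∧ M.eRk (M.E \ B) = M.eRank} ⊆
        {B : Set α | B ⊆ M.E ∧ B.ncard = 6 ∧ M.eRk (M.E \ B) = M.eRank} := fun B hB => ⟨hB.1, hB.2.1, hB.2.2.2⟩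
    exact (Set.ncard_le_ncard hsub (hEfin.finite_subsets.subset (fun B hB => hB.1))).trans
      (S2.ncard_spanning_compl_le_of_nullity M hW hd hWk (m := 6))
  -- the `7`-sets by the complement lever
  have htop7 := S2.ncard_top_seven_le_of_compl_indep M hR hn hW hWcl hhit7
  have hFcrude : {T : Set α | T ⊆ W ∧ T.ncard = 5 ∧ M.Dep T ∧ M.Indep (W \ T)}.ncard ≤ W.ncard.choose 5 := by
    rw [← S2.ncard_subsets_ncard_eq W hWfin 5]
    exact Set.ncard_le_ncard (fun T hT => ⟨hT.1, hT.2.1⟩) (hWfin.finite_subsets.subset (fun T hT => hT.1))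
  have hF10 : W.ncard = 10 → {T : Set α | T ⊆ W ∧ T.ncard = 5 ∧ M.Dep T ∧ M.Indep (W \ T)}.ncard ≤ 126 :=
    fun hw => S2.ncard_dep_compl_indep_five_le M hW hw
  -- the spanning count and the tail
  have hS := S2.ncard_spanning_le_of_nullity M hW hd hWk
  have hA := ncard_eRk_le_five_le_flats M 11 7 (by norm_num) hR hn hfree 10 9 hflat hflat' (by norm_num) (by norm_num)
    (by norm_num) (by norm_num) 11 69 401 hs3 hs4 hs5
  have hA' : ({X : Set α | X ⊆ M.E ∧ M.eRk X ≤ 5}.ncard : ℚ) ≤ 14588414 / 225 := by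
    norm_num [Finset.sum_range_succ, Nat.choose] at hA
    linarith
  rw [hn] at hS htop5 htop6
  rw [hRW] at htop7
  have cellA : ∀ (U S m : ℕ) (A : ℚ), Matroid.topCount M 11 5 ≤ U → ({X : Set α | X ⊆ M.E ∧ M.eRk X ≤ 5}.ncard : ℚ) ≤ A →
      {X : Set α | X ⊆ M.E ∧ M.eRk X = M.eRank}.ncard ≤ S → m ≤ 1024 →
      1024 * (U : ℚ) ≤ ((1024 - m : ℕ) : ℚ) * 2 ^ (7 - 5) * (12107 : ℚ) →
      (1024 : ℚ) * (A + (S : ℚ)) ≤ (m : ℚ) * 2 ^ 18 → ((phiK 13 5 - 6) / 4) * (Matroid.topCount M 11 5 : ℚ) ≤ (Matroid.midCount M 11 5 : ℚ) := by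
    intro U S m A hU hA hS hm hpoly htail
    exact c025_core_five_cell_of_counts_xqictq5g M 11 7 (by norm_num) hR hn U hU A hA S hS
      12107 (by norm_num) ((phiK 13 5 - 6) / 4) (by rw [phiK_thirteen_five]; norm_num) ⟨m, hm, hpoly, htail⟩
  -- the numbers, uniformly in `w ≤ 10`
  generalize hF : {T : Set α | T ⊆ W ∧ T.ncard = 5 ∧ M.Dep T ∧ M.Indep (W \ T)}.ncard = F at htop7 hFcrude hF10
  generalize W.ncard = w at hWn htop5 htop6 htop7 hFcrude hF10 hS
  have hS' : {X : Set α | X ⊆ M.E ∧ M.eRk X = M.eRank}.ncard ≤ 25616 := by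
    refine hS.trans ?_
    interval_cases w <;> decide
  have hU' : Matroid.topCount M 11 5 ≤ 18726 := by
    interval_cases w <;> norm_num [Finset.sum_Icc_succ_top, Nat.choose] at htop5 htop6 htop7 hFcrude hF10 <;> omega
  exact cellA 18726 25616 354 (14588414 / 225) hU' hA' hS' (by norm_num) (by norm_num) (by norm_num)

/-- **The twice-scaled cell `(11, 7)` at `K₂` modulo its case `ν = 4`** (the cases `ν = 6`, `ν = 5` and the spread case are
theorems). -/
theorem c025_eleven_seven_k2_of_nu_four
    (hnu4 : ∀ (M : Matroid α) [M.Finite], M.eRank = ((11 : ℕ) : ℕ∞) → M.E.ncard = 11 + 7 →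
      (∀ e ∈ M.E, ∃ A ⊆ M.E \ {e}, e ∉ M.closure A ∧ e ∉ M.closure ((M.E \ {e}) \ A)) →
      ¬ (∃ W ⊆ M.E, W.ncard ≤ 11 ∧ W.encard = M.eRk W + 6) → ¬ (∃ W ⊆ M.E, W.ncard ≤ 10 ∧ W.encard = M.eRk W + 5) →
      (∃ W ⊆ M.E, W.ncard ≤ 9 ∧ W.encard = M.eRk W + 4) →
      ((phiK 13 5 - 6) / 4) * (Matroid.topCount M 11 5 : ℚ) ≤ (Matroid.midCount M 11 5 : ℚ))
    (M : Matroid α) [M.Finite]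
    (hR : M.eRank = ((11 : ℕ) : ℕ∞)) (hn : M.E.ncard = 11 + 7)
    (hfree : ∀ e ∈ M.E, ∃ A ⊆ M.E \ {e}, e ∉ M.closure A ∧ e ∉ M.closure ((M.E \ {e}) \ A)) :
    ((phiK 13 5 - 6) / 4) * (Matroid.topCount M 11 5 : ℚ) ≤ (Matroid.midCount M 11 5 : ℚ) := by
  classical
  by_cases h6 : ∃ W ⊆ M.E, W.ncard ≤ 11 ∧ W.encard = M.eRk W + 6
  · exact c025_eleven_seven_k2_nu_six M hR hn hfree h6
  by_cases h5 : ∃ W ⊆ M.E, W.ncard ≤ 10 ∧ W.encard = M.eRk W + 5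
  · exact c025_eleven_seven_k2_nu_five M hR hn hfree h6 h5
  by_cases h4 : ∃ W ⊆ M.E, W.ncard ≤ 9 ∧ W.encard = M.eRk W + 4
  · exact hnu4 M hR hn hfree h6 h5 h4
  · exact c025_eleven_seven_k2_spread M hR hn hfree h4

end ThmN

end PercRepro
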